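import Mathlib.Algebra.MvPolynomial.PDeriv
import Mathlib.RingTheory.MvPolynomial.Basic
import Mathlib.Algebra.MvPolynomial.CommRing
import Mathlib.Algebra.CharP.Lemmas
import Mathlib.Tactic.LinearCombination
import HarnessLib

/-!
# MULT specimen (crux `GaloisQuotientModels`, line `inseparability-foliation-quotient`, lead c1):
# an ADDITIVE point of an inseparability foliation produced by the Frobenius/normalisation pipeline

Companion to `Cruxes/GaloisQuotientModels/MD-MECHANISM.md` §2. Characteristic `3`; `X = {y² = x³ + t⁴}`
(an `E₆⁰` double point), fibred by `t`; Frobenius base change `s³ = t` and normalisation give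
`X₁ = 𝔸²` with coordinates `s, w` and `x = w² − s⁴`, `y = w³`, `t = s³`. The level-1 inseparability
foliation `F = T_{X₁/X}` is generated by the derivations of `k[s, w]` killing `x, y, t`; this file
checks, over ANY commutative ring of characteristic `3`, that

* `D := 2w·∂_s + s³·∂_w` kills `x = w² − s⁴`, `y = w³` and `t = s³` (`D_x`, `D_y`, `D_t`), so `D`
  generates `F ⊗ K` (and is visibly saturated: its coefficients `2w`, `s³` have no common factor);
* `D` vanishes at the origin with NILPOTENT linear part and `D³ = 0` on the coordinates (`D_s`,
  `D_D_s`, `D_D_D_s`, `D_w`, `D_D_w`): `D(s) = 2w`, `D²(s) = 2s³`, `D³(s) = 0`, `D(w) = s³`, `D²(w) = 0`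
  — an additive (`α₃`-type), not multiplicative, singular point; its ring of constants
  `k[s,w]^D ⊇ k[s³, w³, w² − s⁴]` is the `E₆⁰` singularity `y² = x³ + t⁴` (in print: arXiv:2602.20703,
  Introduction: "in p = 3 the quotient of k[x,y] by y∂_x + x³∂_y has a rational double point of type
  E₆⁰").

Pure polynomial arithmetic (`MvPolynomial (Fin 2) R`, `pderiv`); no scheme theory.
-/

noncomputable section

-- single-problem summit: the doubled namespace component `ResolutionOfSingularities` is forced
set_option linter.dupNamespace false

open MvPolynomial

namespace Summit.ResolutionOfSingularities.ResolutionOfSingularities.Cruxes.GaloisQuotientModels.MultSpecimen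

variable (R : Type*) [CommRing R]

/-- The coordinate `s` (with `s³ = t`) on `X₁ = 𝔸²`. -/
abbrev s : MvPolynomial (Fin 2) R := X 0

/-- The coordinate `w` (with `w² = x + s⁴`, `w³ = y`) on `X₁ = 𝔸²`. -/
abbrev w : MvPolynomial (Fin 2) R := X 1

/-- The generator `D = 2w·∂_s + s³·∂_w` of the inseparability foliation, as an operator on
`R[s, w]`. -/
def D (f : MvPolynomial (Fin 2) R) : MvPolynomial (Fin 2) R :=
  2 * w R * pderiv 0 f + s R ^ 3 * pderiv 1 f

variable {R}

/-- `∂_s s = 1`. -/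
theorem pderiv_zero_s : pderiv 0 (s R) = 1 := pderiv_X_self 0
/-- `∂_w s = 0`. -/
theorem pderiv_one_s : pderiv 1 (s R) = 0 := pderiv_X_of_ne (by decide)
/-- `∂_s w = 0`. -/
theorem pderiv_zero_w : pderiv 0 (w R) = 0 := pderiv_X_of_ne (by decide)
/-- `∂_w w = 1`. -/
theorem pderiv_one_w : pderiv 1 (w R) = 1 := pderiv_X_self 1
/-- Constants are killed: `∂_i 2 = 0`. -/
theorem pderiv_two (i : Fin 2) : pderiv i (2 : MvPolynomial (Fin 2) R) = 0 := by
  simpa using (pderiv i).map_natCast (2 : ℕ)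

/-- `D(s) = 2w`. -/
theorem D_s : D R (s R) = 2 * w R := by
  simp [D]

/-- `D(w) = s³`. -/
theorem D_w : D R (w R) = s R ^ 3 := by
  simp [D]

/-- `D²(s) = 2s³`. -/
theorem D_D_s : D R (D R (s R)) = 2 * s R ^ 3 := by
  rw [D_s]
  simp only [D, pderiv_mul, pderiv_two, pderiv_zero_w, pderiv_one_w, zero_mul, mul_zero, zero_add,
    mul_one, add_zero]
  ring

variable [CharP R 3]

/-- In characteristic `3`, `3 = 0` in `R[s, w]`. -/
theorem three_eq_zero : (3 : MvPolynomial (Fin 2) R) = 0 := by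
  have h := CharP.cast_eq_zero (MvPolynomial (Fin 2) R) 3
  exact_mod_cast h

/-- `D` kills `x = w² − s⁴`. -/
theorem D_x : D R (w R ^ 2 - s R ^ 4) = 0 := by
  have h3 := three_eq_zero (R := R)
  simp only [D, map_sub, pderiv_pow, pderiv_zero_w, pderiv_zero_s, pderiv_one_w, pderiv_one_s,
    Nat.cast_ofNat, mul_one, mul_zero, zero_sub, sub_zero]
  linear_combination (-(2 : MvPolynomial (Fin 2) R) * w R * s R ^ 3) * h3

/-- `D` kills `y = w³`. -/
theorem D_y : D R (w R ^ 3) = 0 := by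
  have h3 := three_eq_zero (R := R)
  simp only [D, pderiv_pow, pderiv_zero_w, pderiv_one_w, Nat.cast_ofNat, mul_one, mul_zero,
    zero_add]
  linear_combination (s R ^ 3 * w R ^ 2) * h3

/-- `D` kills `t = s³`. -/
theorem D_t : D R (s R ^ 3) = 0 := by
  have h3 := three_eq_zero (R := R)
  simp only [D, pderiv_pow, pderiv_zero_s, pderiv_one_s, Nat.cast_ofNat, mul_one, mul_zero,
    add_zero]
  linear_combination (2 * w R * s R ^ 2) * h3

/-- `D³(s) = 0`: together with `D²(w) = 0`, the linear part of `D` at the origin is nilpotent and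
`D` is additive (`D³ = 0` on coordinates, characteristic `3`). -/
theorem D_D_D_s : D R (D R (D R (s R))) = 0 := by
  rw [D_D_s]
  have h3 := three_eq_zero (R := R)
  simp only [D, pderiv_mul, pderiv_pow, pderiv_two, pderiv_zero_s, pderiv_one_s, Nat.cast_ofNat,
    zero_mul, mul_zero, zero_add, mul_one, add_zero]
  linear_combination (2 * w R * (2 * s R ^ 2)) * h3

/-- `D²(w) = 0`. -/
theorem D_D_w : D R (D R (w R)) = 0 := by
  rw [D_w]
  exact D_t

end Summit.ResolutionOfSingularities.ResolutionOfSingularities.Cruxes.GaloisQuotientModels.MultSpecimen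

end
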